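import Literature.MathematicalPhysics.QuantumFieldTheory.Balaban1983to89.B6RandomWalkL2Hom
import Literature.MathematicalPhysics.QuantumFieldTheory.Balaban1983to89.B6RandomWalkBlocks

/-!
# `Balaban1983to89.B6RandomWalkL2Blocks` — THE BLOCK OPERATOR `(A B; C D)` ON `X ⊕ Y` IN THE BLOCK-`ℓ²` SHAPE (2.140)

The `ℓ²` twin of the majorant half of `B6RandomWalkBlocks` (and of `B6RandomWalkHom` §Embedding): for the ONE endomorphism
`B6RandomWalkBlocks.emb₄ A B C D` of the functions on `X ⊕ Y` (block map `Sum.elim blkX blkY`; [4] p. 232: operators between block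
spaces, composed) —

* §1 `ℓ²` sizes on `X ⊕ Y`: Pythagoras `‖f‖² = ‖f|_X‖² + ‖f|_Y‖²` (`l2n_sum_sq`), `‖f|_X‖, ‖f|_Y‖ ≦ ‖f‖ ≦ ‖f|_X‖ + ‖f|_Y‖`, extension by `0`
  keeps the size, pieces `Δ(y)` and block-supports restrict / extend componentwise;
* §2 TO the one-carrier shape `B6RandomWalkL2.HasL2Majorant`: `K_A, K_B, K_C, K_D ≧ 0` (the last two for the two-carrier shape
  `B6RandomWalkL2Hom.HasL2MajorantHom`) give `(A B; C D) ≺₂ K_A + K_B + K_C + K_D` (`hasL2Majorant_emb₄`; the sup twin has `max`, the `ℓ²`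
  shape pays the sum), the four one-block corollaries `hasL2Majorant_emb₄_inl_inl/_inl_inr/_inr_inl/_inr_inr` with the SAME signatures as
  their sup twins, and the pair `(R 0; S 0) = B6RandomWalkHom.emb R S ≺₂ K_R + K_S` (`hasL2Majorant_emb`);
* §3 FROM it: each block of `(A B; C D) ≺₂ K` is `≺₂ K` (`hasL2Majorant_of_emb₄_inl_inl`, `hasL2MajorantHom_of_emb₄_inl_inr/_inr_inl`,
  `hasL2Majorant_of_emb₄_inr_inr`, `hasL2Majorant_of_emb`, `hasL2MajorantHom_of_emb`).

This is the device by which the operator-form `ℓ²` inequalities on ONE carrier (`B9Ineq377L2.ineq377_l2`, `B9Ineq366L2`, `B9Ineq383L2`,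
`B9Ineq363L2`) are instantiated on the carrier `X ⊕ Y` = sites ⊕ bonds / fine lattice ⊕ 𝔅 of B9 (3.77)/(3.66) with the letters `D, D*`,
`Q′, Q′*` typed between the two function spaces — exactly as `B6RandomWalkBlocks` serves the sup-shape files `B9Ineq377POneConcrete`,
`B9Ineq366CPrime` §4–§6.  The algebra of `emb₄` (`emb₄_mul/_add/_sub/_neg/_smul`, `emb_eq_emb₄`, `embL_eq_emb₄`) is NOT restated — it is
imported from `B6RandomWalkBlocks`.

count-neutral; NOT a node discharge; nothing continuum ∕ OS ∕ mass-gap ∕ Clay.  Cell `pub-ymgap` (HUMAN RULING D-0062), Track A node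
N06 [B9], N06-ASSIGNMENT row 13 (G-side `ℓ²` route), seat `pub-ymgap-dag-n06-c` (g5), 2026-08-27.
-/

noncomputable section

open scoped BigOperators
open Finset

namespace Literature.MathematicalPhysics.QuantumFieldTheory.Balaban1983to89.B6RandomWalkL2Blocks

open B6RandomWalk (blockPiece)
open B6RandomWalkBlocks (emb₄ emb₄_apply_inl emb₄_apply_inr emb_eq_emb₄)
open B6RandomWalkL2 (l2n l2n_nonneg l2n_sq l2n_add_le l2n_zero HasL2Majorant hasL2Majorant_mono)
open B6RandomWalkL2Hom (HasL2MajorantHom)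

variable {g : B6.Geometry} {X Y : Type} [Fintype X] [Fintype Y]

/-! ## §1  `ℓ²` sizes on the carrier `X ⊕ Y` -/

section SumCarrier

/-- `a² ≦ b²`, `b ≧ 0` ⟹ `a ≦ b`. [folklore] -/
private theorem le_of_sq_le_sq {a b : ℝ} (hb : 0 ≤ b) (h : a ^ 2 ≤ b ^ 2) : a ≤ b :=
  (le_abs_self a).trans (abs_le_of_sq_le_sq h hb)

/-- `ℓ²` PYTHAGORAS ON `X ⊕ Y`: `‖f‖² = ‖f|_X‖² + ‖f|_Y‖²`. [cite: Balaban1984PropagatorsII, (2.51)–(2.52) p.232 (bookkeeping, ours)] -/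
theorem l2n_sum_sq (f : X ⊕ Y → ℝ) : l2n f ^ 2 = l2n (f ∘ Sum.inl) ^ 2 + l2n (f ∘ Sum.inr) ^ 2 := by
  simp only [l2n_sq, Fintype.sum_sum_type, Function.comp]

/-- `‖f|_X‖ ≦ ‖f‖` on `X ⊕ Y`. [cite: Balaban1984PropagatorsII, (2.51)–(2.52) p.232 (bookkeeping, ours)] -/
theorem l2n_inl_le (f : X ⊕ Y → ℝ) : l2n (f ∘ Sum.inl) ≤ l2n f :=
  le_of_sq_le_sq (l2n_nonneg f) (by rw [l2n_sum_sq]; nlinarith [sq_nonneg (l2n (f ∘ Sum.inr))])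

/-- `‖f|_Y‖ ≦ ‖f‖` on `X ⊕ Y`. [cite: Balaban1984PropagatorsII, (2.51)–(2.52) p.232 (bookkeeping, ours)] -/
theorem l2n_inr_le (f : X ⊕ Y → ℝ) : l2n (f ∘ Sum.inr) ≤ l2n f :=
  le_of_sq_le_sq (l2n_nonneg f) (by rw [l2n_sum_sq]; nlinarith [sq_nonneg (l2n (f ∘ Sum.inl))])

/-- `‖f‖ ≦ ‖f|_X‖ + ‖f|_Y‖` on `X ⊕ Y`. [cite: Balaban1984PropagatorsII, (2.51)–(2.52) p.232 (bookkeeping, ours)] -/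
theorem l2n_le_inl_add_inr (f : X ⊕ Y → ℝ) : l2n f ≤ l2n (f ∘ Sum.inl) + l2n (f ∘ Sum.inr) :=
  le_of_sq_le_sq (add_nonneg (l2n_nonneg _) (l2n_nonneg _))
    (by rw [l2n_sum_sq]; nlinarith [l2n_nonneg (f ∘ Sum.inl), l2n_nonneg (f ∘ Sum.inr)])

/-- a function on `X` extended by `0` to `X ⊕ Y` keeps its `ℓ²` size. [cite: Balaban1984PropagatorsII, (2.51)–(2.52) p.232 (bookkeeping, ours)] -/
theorem l2n_sumElim_zero_right (μ : X → ℝ) : l2n (Sum.elim μ (0 : Y → ℝ)) = l2n μ := by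
  apply le_antisymm
  · refine (l2n_le_inl_add_inr _).trans ?_
    rw [Sum.elim_comp_inl, Sum.elim_comp_inr, l2n_zero, add_zero]
  · have h := l2n_inl_le (Sum.elim μ (0 : Y → ℝ))
    rwa [Sum.elim_comp_inl] at h

/-- a function on `Y` extended by `0` to `X ⊕ Y` keeps its `ℓ²` size. [cite: Balaban1984PropagatorsII, (2.51)–(2.52) p.232 (bookkeeping, ours)] -/
theorem l2n_sumElim_zero_left (μ : Y → ℝ) : l2n (Sum.elim (0 : X → ℝ) μ) = l2n μ := by
  apply le_antisymm
  · refine (l2n_le_inl_add_inr _).trans ?_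
    rw [Sum.elim_comp_inl, Sum.elim_comp_inr, l2n_zero, zero_add]
  · have h := l2n_inr_le (Sum.elim (0 : X → ℝ) μ)
    rwa [Sum.elim_comp_inr] at h

omit [Fintype X] [Fintype Y] in
/-- the `X`-part of a piece `Δ(y)f` over the block map `Sum.elim blkX blkY` is the piece `Δ(y)(f|_X)`. [cite: Balaban1984PropagatorsII, (2.52) p.232 (bookkeeping, ours)] -/
theorem blockPiece_sumElim_comp_inl (blkX : X → g.Site) (blkY : Y → g.Site) (y : g.Site) (f : X ⊕ Y → ℝ) :
    blockPiece (Sum.elim blkX blkY) y f ∘ Sum.inl = blockPiece blkX y (f ∘ Sum.inl) := by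
  funext x; rfl

omit [Fintype X] [Fintype Y] in
/-- the `Y`-part of a piece `Δ(y)f` over `Sum.elim blkX blkY` is `Δ(y)(f|_Y)`. [cite: Balaban1984PropagatorsII, (2.52) p.232 (bookkeeping, ours)] -/
theorem blockPiece_sumElim_comp_inr (blkX : X → g.Site) (blkY : Y → g.Site) (y : g.Site) (f : X ⊕ Y → ℝ) :
    blockPiece (Sum.elim blkX blkY) y f ∘ Sum.inr = blockPiece blkY y (f ∘ Sum.inr) := by
  funext v; rfl

omit [Fintype X] [Fintype Y] in
/-- a test function on `X ⊕ Y` supported in the block `y′` restricts to one on `X` supported in the block `y′`.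
[cite: Balaban1984PropagatorsII, (2.51) p.232 (bookkeeping, ours)] -/
theorem supported_comp_inl {blkX : X → g.Site} {blkY : Y → g.Site} {y' : g.Site} {u : X ⊕ Y → ℝ}
    (hu : ∀ z, Sum.elim blkX blkY z ≠ y' → u z = 0) : ∀ x, blkX x ≠ y' → (u ∘ Sum.inl) x = 0 :=
  fun x hx => hu (Sum.inl x) hx

omit [Fintype X] [Fintype Y] in
/-- … and to one on `Y` supported in the block `y′`. [cite: Balaban1984PropagatorsII, (2.51) p.232 (bookkeeping, ours)] -/
theorem supported_comp_inr {blkX : X → g.Site} {blkY : Y → g.Site} {y' : g.Site} {u : X ⊕ Y → ℝ}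
    (hu : ∀ z, Sum.elim blkX blkY z ≠ y' → u z = 0) : ∀ v, blkY v ≠ y' → (u ∘ Sum.inr) v = 0 :=
  fun v hv => hu (Sum.inr v) hv

omit [Fintype X] [Fintype Y] in
/-- a test function on `X` supported in the block `y′`, extended by `0`, is supported in the block `y′` of `X ⊕ Y`.
[cite: Balaban1984PropagatorsII, (2.51) p.232 (bookkeeping, ours)] -/
theorem supported_sumElim_zero_right {blkX : X → g.Site} {blkY : Y → g.Site} {y' : g.Site} {μ : X → ℝ}
    (hμ : ∀ x, blkX x ≠ y' → μ x = 0) : ∀ z, Sum.elim blkX blkY z ≠ y' → Sum.elim μ (0 : Y → ℝ) z = 0 := by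
  rintro (x | v) h
  · exact hμ x h
  · rfl

omit [Fintype X] [Fintype Y] in
/-- a test function on `Y` supported in the block `y′`, extended by `0`, is supported in the block `y′` of `X ⊕ Y`.
[cite: Balaban1984PropagatorsII, (2.51) p.232 (bookkeeping, ours)] -/
theorem supported_sumElim_zero_left {blkX : X → g.Site} {blkY : Y → g.Site} {y' : g.Site} {μ : Y → ℝ}
    (hμ : ∀ v, blkY v ≠ y' → μ v = 0) : ∀ z, Sum.elim blkX blkY z ≠ y' → Sum.elim (0 : X → ℝ) μ z = 0 := by
  rintro (x | v) h
  · rfl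
  · exact hμ v h

end SumCarrier

/-! ## §2  TO the one-carrier shape: `(A B; C D) ≺₂ K_A + K_B + K_C + K_D` -/

section To

/-- **TO `B6RandomWalkL2`**: block-`ℓ²` majorants `K_A ≧ 0` of `A`, `K_B ≧ 0` of `B : Y → X`, `K_C ≧ 0` of `C : X → Y`, `K_D ≧ 0` of `D` give the
block-`ℓ²` majorant `K_A + K_B + K_C + K_D` of `(A B; C D)` over `Sum.elim blkX blkY` (a test function supported in the block `y′` of `X ⊕ Y` restricts to
test functions on `X` and on `Y` supported in `y′`, of no larger `ℓ²` size; the piece `Δ(y)` of the image has `ℓ²` size at most the sum of the sizes of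
its `X`- and `Y`-parts).  The `ℓ²` twin of `B6RandomWalkBlocks.hasMajorant_emb₄` (there: `max`, here: sum).
[cite: Balaban1984PropagatorsII, (2.51)–(2.52) p.232 + (2.140) p.247] -/
theorem hasL2Majorant_emb₄ {blkX : X → g.Site} {blkY : Y → g.Site} {A : Module.End ℝ (X → ℝ)} {B : (Y → ℝ) →ₗ[ℝ] (X → ℝ)}
    {C : (X → ℝ) →ₗ[ℝ] (Y → ℝ)} {D : Module.End ℝ (Y → ℝ)} {KA KB KC KD : g.Site → g.Site → ℝ}
    (hA : HasL2Majorant blkX A KA) (hB : HasL2MajorantHom blkY blkX B KB) (hC : HasL2MajorantHom blkX blkY C KC)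
    (hD : HasL2Majorant blkY D KD) (hKA : ∀ a b, 0 ≤ KA a b) (hKB : ∀ a b, 0 ≤ KB a b) (hKC : ∀ a b, 0 ≤ KC a b)
    (hKD : ∀ a b, 0 ≤ KD a b) :
    HasL2Majorant (Sum.elim blkX blkY) (emb₄ A B C D) (fun a b => KA a b + KB a b + KC a b + KD a b) := by
  intro y y' u hu
  have huX := supported_comp_inl hu
  have huY := supported_comp_inr hu
  have hXle : l2n (u ∘ Sum.inl) ≤ l2n u := l2n_inl_le u
  have hYle : l2n (u ∘ Sum.inr) ≤ l2n u := l2n_inr_le u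
  have h1 := hA y y' _ huX
  have h2 := hB y y' _ huY
  have h3 := hC y y' _ huX
  have h4 := hD y y' _ huY
  have einl : blockPiece (Sum.elim blkX blkY) y (emb₄ A B C D u) ∘ Sum.inl =
      blockPiece blkX y (A (u ∘ Sum.inl)) + blockPiece blkX y (B (u ∘ Sum.inr)) := by
    rw [blockPiece_sumElim_comp_inl, ← B6RandomWalkL2.blockPiece_add]
    rfl
  have einr : blockPiece (Sum.elim blkX blkY) y (emb₄ A B C D u) ∘ Sum.inr =
      blockPiece blkY y (C (u ∘ Sum.inl)) + blockPiece blkY y (D (u ∘ Sum.inr)) := by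
    rw [blockPiece_sumElim_comp_inr, ← B6RandomWalkL2.blockPiece_add]
    rfl
  refine (l2n_le_inl_add_inr _).trans ?_
  rw [einl, einr]
  refine (add_le_add (l2n_add_le _ _) (l2n_add_le _ _)).trans ?_
  have hu0 := l2n_nonneg u
  have := hKA y y'; have := hKB y y'; have := hKC y y'; have := hKD y y'
  nlinarith [mul_le_mul_of_nonneg_left hXle (hKA y y'), mul_le_mul_of_nonneg_left hYle (hKB y y'),
    mul_le_mul_of_nonneg_left hXle (hKC y y'), mul_le_mul_of_nonneg_left hYle (hKD y y')]

/-- the zero homomorphism has the zero `ℓ²` majorant. [cite: Balaban1984PropagatorsII, (2.52) p.232 (bookkeeping, ours)] -/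
theorem hasL2MajorantHom_zero (blkX : X → g.Site) (blkY : Y → g.Site) :
    HasL2MajorantHom blkX blkY (0 : (X → ℝ) →ₗ[ℝ] (Y → ℝ)) (fun _ _ => 0) := by
  intro y y' u _
  have : blockPiece blkY y ((0 : (X → ℝ) →ₗ[ℝ] (Y → ℝ)) u) = 0 := by
    funext v; by_cases hv : blkY v = y <;> simp [blockPiece, hv]
  rw [this, l2n_zero, zero_mul]

/-- TO, one block: `(A 0; 0 0) ≺₂ K` for the majorants `K ≧ 0` of `A`. [cite: Balaban1984PropagatorsII, (2.51) p.232 + (2.140) p.247] -/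
theorem hasL2Majorant_emb₄_inl_inl {blkX : X → g.Site} {blkY : Y → g.Site} {A : Module.End ℝ (X → ℝ)} {K : g.Site → g.Site → ℝ}
    (hA : HasL2Majorant blkX A K) (hK : ∀ a b, 0 ≤ K a b) :
    HasL2Majorant (Sum.elim blkX blkY) (emb₄ A (0 : (Y → ℝ) →ₗ[ℝ] (X → ℝ)) (0 : (X → ℝ) →ₗ[ℝ] (Y → ℝ)) 0) K := by
  refine hasL2Majorant_mono _ (hasL2Majorant_emb₄ hA (hasL2MajorantHom_zero blkY blkX) (hasL2MajorantHom_zero blkX blkY)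
    (B6RandomWalkL2.hasL2Majorant_zero blkY) hK (fun _ _ => le_rfl) (fun _ _ => le_rfl) (fun _ _ => le_rfl)) ?_
  intro a b; simp

/-- TO, one block: `(0 B; 0 0) ≺₂ K` for the two-carrier majorants `K ≧ 0` of `B : Y → X`. [cite: Balaban1984PropagatorsII, (2.51) p.232 + (2.140) p.247] -/
theorem hasL2Majorant_emb₄_inl_inr {blkX : X → g.Site} {blkY : Y → g.Site} {B : (Y → ℝ) →ₗ[ℝ] (X → ℝ)} {K : g.Site → g.Site → ℝ}
    (hB : HasL2MajorantHom blkY blkX B K) (hK : ∀ a b, 0 ≤ K a b) :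
    HasL2Majorant (Sum.elim blkX blkY) (emb₄ (0 : Module.End ℝ (X → ℝ)) B (0 : (X → ℝ) →ₗ[ℝ] (Y → ℝ)) 0) K := by
  refine hasL2Majorant_mono _ (hasL2Majorant_emb₄ (B6RandomWalkL2.hasL2Majorant_zero blkX) hB (hasL2MajorantHom_zero blkX blkY)
    (B6RandomWalkL2.hasL2Majorant_zero blkY) (fun _ _ => le_rfl) hK (fun _ _ => le_rfl) (fun _ _ => le_rfl)) ?_
  intro a b; simp

/-- TO, one block: `(0 0; C 0) ≺₂ K` for the two-carrier majorants `K ≧ 0` of `C : X → Y`. [cite: Balaban1984PropagatorsII, (2.51) p.232 + (2.140) p.247] -/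
theorem hasL2Majorant_emb₄_inr_inl {blkX : X → g.Site} {blkY : Y → g.Site} {C : (X → ℝ) →ₗ[ℝ] (Y → ℝ)} {K : g.Site → g.Site → ℝ}
    (hC : HasL2MajorantHom blkX blkY C K) (hK : ∀ a b, 0 ≤ K a b) :
    HasL2Majorant (Sum.elim blkX blkY) (emb₄ (0 : Module.End ℝ (X → ℝ)) (0 : (Y → ℝ) →ₗ[ℝ] (X → ℝ)) C 0) K := by
  refine hasL2Majorant_mono _ (hasL2Majorant_emb₄ (B6RandomWalkL2.hasL2Majorant_zero blkX) (hasL2MajorantHom_zero blkY blkX) hC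
    (B6RandomWalkL2.hasL2Majorant_zero blkY) (fun _ _ => le_rfl) (fun _ _ => le_rfl) hK (fun _ _ => le_rfl)) ?_
  intro a b; simp

/-- TO, one block: `(0 0; 0 D) ≺₂ K` for the majorants `K ≧ 0` of `D`. [cite: Balaban1984PropagatorsII, (2.51) p.232 + (2.140) p.247] -/
theorem hasL2Majorant_emb₄_inr_inr {blkX : X → g.Site} {blkY : Y → g.Site} {D : Module.End ℝ (Y → ℝ)} {K : g.Site → g.Site → ℝ}
    (hD : HasL2Majorant blkY D K) (hK : ∀ a b, 0 ≤ K a b) :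
    HasL2Majorant (Sum.elim blkX blkY)
      (emb₄ (0 : Module.End ℝ (X → ℝ)) (0 : (Y → ℝ) →ₗ[ℝ] (X → ℝ)) (0 : (X → ℝ) →ₗ[ℝ] (Y → ℝ)) D) K := by
  refine hasL2Majorant_mono _ (hasL2Majorant_emb₄ (B6RandomWalkL2.hasL2Majorant_zero blkX) (hasL2MajorantHom_zero blkY blkX)
    (hasL2MajorantHom_zero blkX blkY) hD (fun _ _ => le_rfl) (fun _ _ => le_rfl) (fun _ _ => le_rfl) hK) ?_
  intro a b; simp

/-- TO, the pair `(R 0; S 0)` of `B6RandomWalkHom.emb`: `K_R ≧ 0` of `R` and `K_S ≧ 0` of `S : X → Y` give `(R 0; S 0) ≺₂ K_R + K_S`.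
[cite: Balaban1984PropagatorsII, (2.51) p.232 + (2.140) p.247] -/
theorem hasL2Majorant_emb {blkX : X → g.Site} {blkY : Y → g.Site} {R : Module.End ℝ (X → ℝ)} {S : (X → ℝ) →ₗ[ℝ] (Y → ℝ)}
    {KR KS : g.Site → g.Site → ℝ} (hR : HasL2Majorant blkX R KR) (hS : HasL2MajorantHom blkX blkY S KS)
    (hKR : ∀ a b, 0 ≤ KR a b) (hKS : ∀ a b, 0 ≤ KS a b) :
    HasL2Majorant (Sum.elim blkX blkY) (B6RandomWalkHom.emb R S) (fun a b => KR a b + KS a b) := by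
  rw [emb_eq_emb₄]
  refine hasL2Majorant_mono _ (hasL2Majorant_emb₄ hR (hasL2MajorantHom_zero blkY blkX) hS
    (B6RandomWalkL2.hasL2Majorant_zero blkY) hKR (fun _ _ => le_rfl) hKS (fun _ _ => le_rfl)) ?_
  intro a b; simp

end To

/-! ## §3  FROM the one-carrier shape: each block of `(A B; C D) ≺₂ K` is `≺₂ K` -/

section From

/-- **FROM, block `A`**: an `ℓ²` majorant of `(A B; C D)` over `X ⊕ Y` is one of `A` (test functions extended by `0` from `X`; the `X`-part of a piece
is no larger than the piece). [cite: Balaban1984PropagatorsII, (2.51) p.232 + (2.140) p.247] -/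
theorem hasL2Majorant_of_emb₄_inl_inl {blkX : X → g.Site} {blkY : Y → g.Site} {A : Module.End ℝ (X → ℝ)} {B : (Y → ℝ) →ₗ[ℝ] (X → ℝ)}
    {C : (X → ℝ) →ₗ[ℝ] (Y → ℝ)} {D : Module.End ℝ (Y → ℝ)} {K : g.Site → g.Site → ℝ}
    (h : HasL2Majorant (Sum.elim blkX blkY) (emb₄ A B C D) K) : HasL2Majorant blkX A K := by
  intro y y' μ hμ
  have h1 := h y y' (Sum.elim μ 0) (supported_sumElim_zero_right hμ)
  rw [l2n_sumElim_zero_right] at h1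
  refine le_trans ?_ ((l2n_inl_le _).trans h1)
  rw [blockPiece_sumElim_comp_inl]
  apply le_of_eq; congr 1; funext x
  simp [blockPiece, emb₄_apply_inl]

/-- **FROM, block `B`**: an `ℓ²` majorant of `(A B; C D)` is a two-carrier one of `B : Y → X`. [cite: Balaban1984PropagatorsII, (2.51) p.232 + (2.140) p.247] -/
theorem hasL2MajorantHom_of_emb₄_inl_inr {blkX : X → g.Site} {blkY : Y → g.Site} {A : Module.End ℝ (X → ℝ)}
    {B : (Y → ℝ) →ₗ[ℝ] (X → ℝ)} {C : (X → ℝ) →ₗ[ℝ] (Y → ℝ)} {D : Module.End ℝ (Y → ℝ)} {K : g.Site → g.Site → ℝ}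
    (h : HasL2Majorant (Sum.elim blkX blkY) (emb₄ A B C D) K) : HasL2MajorantHom blkY blkX B K := by
  intro y y' μ hμ
  have h1 := h y y' (Sum.elim 0 μ) (supported_sumElim_zero_left hμ)
  rw [l2n_sumElim_zero_left] at h1
  refine le_trans ?_ ((l2n_inl_le _).trans h1)
  rw [blockPiece_sumElim_comp_inl]
  apply le_of_eq; congr 1; funext x
  simp [blockPiece, emb₄_apply_inl]

/-- **FROM, block `C`**: an `ℓ²` majorant of `(A B; C D)` is a two-carrier one of `C : X → Y`. [cite: Balaban1984PropagatorsII, (2.51) p.232 + (2.140) p.247] -/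
theorem hasL2MajorantHom_of_emb₄_inr_inl {blkX : X → g.Site} {blkY : Y → g.Site} {A : Module.End ℝ (X → ℝ)}
    {B : (Y → ℝ) →ₗ[ℝ] (X → ℝ)} {C : (X → ℝ) →ₗ[ℝ] (Y → ℝ)} {D : Module.End ℝ (Y → ℝ)} {K : g.Site → g.Site → ℝ}
    (h : HasL2Majorant (Sum.elim blkX blkY) (emb₄ A B C D) K) : HasL2MajorantHom blkX blkY C K := by
  intro y y' μ hμ
  have h1 := h y y' (Sum.elim μ 0) (supported_sumElim_zero_right hμ)
  rw [l2n_sumElim_zero_right] at h1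
  refine le_trans ?_ ((l2n_inr_le _).trans h1)
  rw [blockPiece_sumElim_comp_inr]
  apply le_of_eq; congr 1; funext v
  simp [blockPiece, emb₄_apply_inr]

/-- **FROM, block `D`**: an `ℓ²` majorant of `(A B; C D)` is one of `D`. [cite: Balaban1984PropagatorsII, (2.51) p.232 + (2.140) p.247] -/
theorem hasL2Majorant_of_emb₄_inr_inr {blkX : X → g.Site} {blkY : Y → g.Site} {A : Module.End ℝ (X → ℝ)} {B : (Y → ℝ) →ₗ[ℝ] (X → ℝ)}
    {C : (X → ℝ) →ₗ[ℝ] (Y → ℝ)} {D : Module.End ℝ (Y → ℝ)} {K : g.Site → g.Site → ℝ}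
    (h : HasL2Majorant (Sum.elim blkX blkY) (emb₄ A B C D) K) : HasL2Majorant blkY D K := by
  intro y y' μ hμ
  have h1 := h y y' (Sum.elim 0 μ) (supported_sumElim_zero_left hμ)
  rw [l2n_sumElim_zero_left] at h1
  refine le_trans ?_ ((l2n_inr_le _).trans h1)
  rw [blockPiece_sumElim_comp_inr]
  apply le_of_eq; congr 1; funext v
  simp [blockPiece, emb₄_apply_inr]

/-- FROM, the pair `(R 0; S 0)`: an `ℓ²` majorant of `B6RandomWalkHom.emb R S` is one of `R`. [cite: Balaban1984PropagatorsII, (2.51) p.232 + (2.140) p.247] -/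
theorem hasL2Majorant_of_emb {blkX : X → g.Site} {blkY : Y → g.Site} {R : Module.End ℝ (X → ℝ)} {S : (X → ℝ) →ₗ[ℝ] (Y → ℝ)}
    {K : g.Site → g.Site → ℝ} (h : HasL2Majorant (Sum.elim blkX blkY) (B6RandomWalkHom.emb R S) K) : HasL2Majorant blkX R K := by
  rw [emb_eq_emb₄] at h
  exact hasL2Majorant_of_emb₄_inl_inl h

/-- FROM, the pair `(R 0; S 0)`: an `ℓ²` majorant of `B6RandomWalkHom.emb R S` is a two-carrier one of `S`. [cite: Balaban1984PropagatorsII, (2.51) p.232 + (2.140) p.247] -/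
theorem hasL2MajorantHom_of_emb {blkX : X → g.Site} {blkY : Y → g.Site} {R : Module.End ℝ (X → ℝ)} {S : (X → ℝ) →ₗ[ℝ] (Y → ℝ)}
    {K : g.Site → g.Site → ℝ} (h : HasL2Majorant (Sum.elim blkX blkY) (B6RandomWalkHom.emb R S) K) : HasL2MajorantHom blkX blkY S K := by
  rw [emb_eq_emb₄] at h
  exact hasL2MajorantHom_of_emb₄_inr_inl h

end From

end Literature.MathematicalPhysics.QuantumFieldTheory.Balaban1983to89.B6RandomWalkL2Blocks
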